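import Literature.Barriers.FinalStateConjecture.KleinGordonModeConstruction
import Literature.Analysis.ODE.HeunLocalSeries
import Literature.Analysis.ODE.LinearSecondOrder
import HarnessLib

/-!
# Horizon-regular solutions of the radial Klein–Gordon equation on Kerr, holomorphic in the
# parameters

Topic `Literature/Barriers/FinalStateConjecture`. The radial half (horizon end) of the data of
`ShlapentokhRothman2014_separatedMode`: for sub-extremal Kerr `(M, a)`, `m ∈ ℤ`, complex
`(ω, Λ)` and real `μ`, with `ω` close to `ω₀ = am/(2Mr₊)` (precisely `|2Mr₊ω − am| < (r₊−r₋)/8`),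
we construct a solution `R` of the radial ODE (2.2),
`Δ d/dr(Δ dR/dr) = V R` on `(r₊, ∞)` (`IsRadialSolution`), of the HORIZON FORM (2.3)
`R = e^{−i(ω t̄(r) − m φ̄(r))} f(r)` with `f` smooth on `(r₊ − η, ∞)` — the boundary condition
"smooth up to the future event horizon in Kerr-star coordinates" of Shlapentokh-Rothman, CMP 329
(2014), §2 — and not identically zero. Construction (`SR Lemma 4.5` rendered constructively):
`R = P · ρ` with `P = e^{−i(ωt̄ − mφ̄)}` the horizon phase (`ΔP' = −iK(r)P`,
`K(r) = ω(r² + a²) − am`) and `ρ(r) = heunFun p ((r − r₊)/(r₊ − r₋))` the analytic solution at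
the regular singular point `r₊` of the confluent-Heun normal form
`Δρ'' + (Δ' − 2iK)ρ' + (2amω − λ − a²ω² − μ²r² − 2iωr)ρ = 0` (`Literature.Analysis.ODE.HeunLocalSeries`),
extended from `(r₊, r₊ + 2(r₊−r₋)/5)` to `(r₊, ∞)` by the linear flow
(`Literature.Analysis.ODE.exists_contDiffOn_solution_Ioi`). Everything is proved.

## References

* Y. Shlapentokh-Rothman, Comm. Math. Phys. 329 (2014) 859–891, §2 (2.2)–(2.3), Lemma 4.5.
  Key `ShlapentokhRothman2014KleinGordon`.
* P. Hartman, *Ordinary Differential Equations*, SIAM Classics 38 (2002), Ch. IV §12. Key `Hartman2002`.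
-/

noncomputable section

open Set Filter Complex
open scoped Topology Real ContDiff

namespace Literature.Barriers.FinalStateConjecture

open Literature.Geometry.Lorentzian Literature.Geometry.Lorentzian.Kerr Literature.Analysis.ODE

/-! ### The parameters of the normal form -/

section Params

variable (M a : ℝ) (m : ℤ) (w Λ : ℂ) (μ : ℝ)

/-- `c = r₊ − r₋`. [folklore] -/
def hzC (M a : ℝ) : ℝ := rPlus M a - rMinus M a

/-- `K₊ = 2Mr₊w − am` (`= K(r₊)`, `K(r) = w(r² + a²) − am`). [cite: ShlapentokhRothman2014KleinGordon, §2 (2.3)] -/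
def hzKplus (M a : ℝ) (m : ℤ) (w : ℂ) : ℂ := 2 * M * rPlus M a * w - a * m

/-- **The six Heun parameters** `p = (α₀, α₁, α₂, β₀, β₁, β₂)` of the normal form at the horizon
(`ξ = (r − r₊)/c`): `α₀ = −2iK₊/c`, `α₁ = 2 − 4iwr₊`, `α₂ = −2iwc`,
`β₀ = 2amw − Λ − a²w² − μ²r₊² − 2iwr₊`, `β₁ = (−2μ²r₊ − 2iw)c`, `β₂ = −μ²c²`. [folklore] -/
def hzParam : HP :=
  ![-2 * I * hzKplus M a m w / (hzC M a : ℂ),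
    2 - 4 * I * w * rPlus M a,
    -2 * I * w * (hzC M a : ℂ),
    2 * a * m * w - Λ - a ^ 2 * w ^ 2 - μ ^ 2 * rPlus M a ^ 2 - 2 * I * w * rPlus M a,
    (-2 * μ ^ 2 * rPlus M a - 2 * I * w) * (hzC M a : ℂ),
    -μ ^ 2 * (hzC M a : ℂ) ^ 2]

/-- Component of `hzParam`. [folklore] -/
@[simp] theorem hzParam_zero : hzParam M a m w Λ μ 0 = -2 * I * hzKplus M a m w / (hzC M a : ℂ) := rfl
/-- Component of `hzParam`. [folklore] -/
@[simp] theorem hzParam_one : hzParam M a m w Λ μ 1 = 2 - 4 * I * w * rPlus M a := rfl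
/-- Component of `hzParam`. [folklore] -/
@[simp] theorem hzParam_two : hzParam M a m w Λ μ 2 = -2 * I * w * (hzC M a : ℂ) := rfl
/-- Component of `hzParam`. [folklore] -/
@[simp] theorem hzParam_three : hzParam M a m w Λ μ 3 =
    2 * a * m * w - Λ - a ^ 2 * w ^ 2 - μ ^ 2 * rPlus M a ^ 2 - 2 * I * w * rPlus M a := rfl
/-- Component of `hzParam`. [folklore] -/
@[simp] theorem hzParam_four : hzParam M a m w Λ μ 4 = (-2 * μ ^ 2 * rPlus M a - 2 * I * w) * (hzC M a : ℂ) := rfl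
/-- Component of `hzParam`. [folklore] -/
@[simp] theorem hzParam_five : hzParam M a m w Λ μ 5 = -μ ^ 2 * (hzC M a : ℂ) ^ 2 := rfl

variable {M a}

/-- `c > 0` for sub-extremal parameters. [folklore] -/
theorem hzC_pos (h : IsSubextremal M a) : 0 < hzC M a := sub_pos.2 h.rMinus_lt_rPlus

/-- **The smallness of `α₀`**: `‖α₀‖ = 2‖K₊‖/c < 1/4` iff `‖K₊‖ < c/8`. [folklore] -/
theorem norm_hzParam_zero_lt (h : IsSubextremal M a) (hK : ‖hzKplus M a m w‖ < hzC M a / 8) :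
    ‖hzParam M a m w Λ μ 0‖ < 1 / 4 := by
  have hc := hzC_pos h
  rw [hzParam_zero, norm_div, Complex.norm_real, Real.norm_eq_abs, abs_of_pos hc, norm_mul, norm_mul, norm_neg,
    Complex.norm_two, Complex.norm_I, mul_one, div_lt_iff₀ hc]
  linarith

end Params

/-! ### The analytic factor `ρ` and its equation in `r` -/

section Rho

variable {M a : ℝ} {m : ℤ} {w Λ : ℂ} {μ : ℝ}

/-- The normal-form variable `ξ(ζ) = (ζ − r₊)/c` (complex affine). [folklore] -/
def hzXi (M a : ℝ) (ζ : ℂ) : ℂ := (ζ - rPlus M a) / (hzC M a : ℂ)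

/-- **The analytic factor** `ρ(ζ) = heunFun p ((ζ − r₊)/c)` as a function of complex `ζ`
(evaluated at real `r` below). [cite: ShlapentokhRothman2014KleinGordon, §2 (2.3)] -/
def hzRhoC (M a : ℝ) (m : ℤ) (w Λ : ℂ) (μ : ℝ) (ζ : ℂ) : ℂ := heunFun (hzParam M a m w Λ μ) (hzXi M a ζ)

/-- Its first `ζ`-derivative. [folklore] -/
def hzRhoC' (M a : ℝ) (m : ℤ) (w Λ : ℂ) (μ : ℝ) (ζ : ℂ) : ℂ :=
  heunDer (hzParam M a m w Λ μ) (hzXi M a ζ) / (hzC M a : ℂ)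

/-- Its second `ζ`-derivative. [folklore] -/
def hzRhoC'' (M a : ℝ) (m : ℤ) (w Λ : ℂ) (μ : ℝ) (ζ : ℂ) : ℂ :=
  heunDer2 (hzParam M a m w Λ μ) (hzXi M a ζ) / (hzC M a : ℂ) ^ 2

/-- The disc `‖ζ − r₊‖ < 2c/5` maps into `‖ξ‖ < 2/5`. [folklore] -/
theorem norm_hzXi_lt (h : IsSubextremal M a) {ζ : ℂ} (hζ : ‖ζ - rPlus M a‖ < 2 * hzC M a / 5) : ‖hzXi M a ζ‖ < 2 / 5 := by
  have hc := hzC_pos h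
  rw [hzXi, norm_div, Complex.norm_real, Real.norm_eq_abs, abs_of_pos hc, div_lt_iff₀ hc]
  linarith

/-- `dξ/dζ = 1/c`. [folklore] -/
theorem hasDerivAt_hzXi (ζ : ℂ) : HasDerivAt (hzXi M a) (1 / (hzC M a : ℂ)) ζ := by
  unfold hzXi
  have h := ((hasDerivAt_id ζ).sub_const ((rPlus M a : ℝ) : ℂ)).div_const ((hzC M a : ℝ) : ℂ)
  simpa using h

variable (h : IsSubextremal M a) (hK : ‖hzKplus M a m w‖ < hzC M a / 8)
include h hK

/-- `dρ/dζ = ρ'`. [folklore] -/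
theorem hasDerivAt_hzRhoC {ζ : ℂ} (hζ : ‖ζ - rPlus M a‖ < 2 * hzC M a / 5) :
    HasDerivAt (hzRhoC M a m w Λ μ) (hzRhoC' M a m w Λ μ ζ) ζ := by
  have hα := (norm_hzParam_zero_lt m w Λ μ h hK).le
  have h1 := (hasDerivAt_heunFun hα (norm_hzXi_lt h hζ)).comp ζ (hasDerivAt_hzXi ζ)
  rw [hzRhoC', div_eq_mul_one_div]
  exact h1

/-- `dρ'/dζ = ρ''`. [folklore] -/
theorem hasDerivAt_hzRhoC' {ζ : ℂ} (hζ : ‖ζ - rPlus M a‖ < 2 * hzC M a / 5) :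
    HasDerivAt (hzRhoC' M a m w Λ μ) (hzRhoC'' M a m w Λ μ ζ) ζ := by
  have hα := (norm_hzParam_zero_lt m w Λ μ h hK).le
  have h1 := ((hasDerivAt_heunDer hα (norm_hzXi_lt h hζ)).comp ζ (hasDerivAt_hzXi ζ)).div_const ((hzC M a : ℝ) : ℂ)
  unfold hzRhoC'
  refine h1.congr_deriv ?_
  rw [hzRhoC'']
  field_simp

/-- **The normal form in the radial variable** (complex `ζ` with `‖ζ − r₊‖ < 2c/5`):
`Δ(ζ)ρ'' + (Δ'(ζ) − 2iK(ζ))ρ' + (2amw − Λ − a²w² − μ²ζ² − 2iwζ)ρ = 0`, where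
`Δ(ζ) = (ζ − r₊)(ζ − r₋)`, `Δ' = 2ζ − 2M`, `K(ζ) = w(ζ² + a²) − am`. [cite: ShlapentokhRothman2014KleinGordon, §2 (2.2)–(2.3)] -/
theorem hzRhoC_ode {ζ : ℂ} (hζ : ‖ζ - rPlus M a‖ < 2 * hzC M a / 5) :
    (ζ - rPlus M a) * (ζ - rMinus M a) * hzRhoC'' M a m w Λ μ ζ +
      (2 * ζ - 2 * M - 2 * I * (w * (ζ ^ 2 + a ^ 2) - a * m)) * hzRhoC' M a m w Λ μ ζ +
      (2 * a * m * w - Λ - a ^ 2 * w ^ 2 - μ ^ 2 * ζ ^ 2 - 2 * I * w * ζ) * hzRhoC M a m w Λ μ ζ = 0 := by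
  have hα := (norm_hzParam_zero_lt m w Λ μ h hK).le
  have hode := heunFun_ode (p := hzParam M a m w Λ μ) hα (norm_hzXi_lt h hζ)
  simp only [hzParam_zero, hzParam_one, hzParam_two, hzParam_three, hzParam_four, hzParam_five, hzKplus] at hode
  -- Kerr identities: `2M = r₊ + r₋`, `r₊² + a² = 2Mr₊`, `c = r₊ − r₋`
  have hsum : ((rPlus M a : ℝ) : ℂ) + rMinus M a = 2 * M := by exact_mod_cast rPlus_add_rMinus M a
  have hsq : ((rPlus M a : ℝ) : ℂ) ^ 2 + a ^ 2 = 2 * M * rPlus M a := by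
    have h0 := delta_rPlus h.le
    unfold delta at h0
    have : rPlus M a ^ 2 + a ^ 2 = 2 * M * rPlus M a := by linarith
    exact_mod_cast this
  have hcdef : ((hzC M a : ℝ) : ℂ) = rPlus M a - rMinus M a := by unfold hzC; push_cast; ring
  have hc' : ((rPlus M a : ℝ) : ℂ) - rMinus M a ≠ 0 := by
    rw [← hcdef]; exact_mod_cast (hzC_pos h).ne'
  have hM2 : (M : ℂ) = (rPlus M a + rMinus M a) / 2 := by linear_combination -hsum / 2
  have ha2 : (a : ℂ) ^ 2 = (rPlus M a + rMinus M a) * rPlus M a - rPlus M a ^ 2 := by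
    linear_combination hsq + (rPlus M a : ℂ) * (-hsum)
  unfold hzRhoC hzRhoC' hzRhoC''
  set F := heunFun (hzParam M a m w Λ μ) (hzXi M a ζ)
  set F1 := heunDer (hzParam M a m w Λ μ) (hzXi M a ζ)
  set F2 := heunDer2 (hzParam M a m w Λ μ) (hzXi M a ζ)
  have hξ : hzXi M a ζ = (ζ - rPlus M a) / (hzC M a : ℂ) := rfl
  rw [hξ, hcdef] at hode
  rw [hcdef]
  -- eliminate `M` and `a²`
  rw [show ζ ^ 2 + (a : ℂ) ^ 2 = ζ ^ 2 + ((rPlus M a + rMinus M a) * rPlus M a - rPlus M a ^ 2) by rw [ha2],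
    show (a : ℂ) ^ 2 * w ^ 2 = ((rPlus M a + rMinus M a) * rPlus M a - rPlus M a ^ 2) * w ^ 2 by rw [ha2], hM2]
  rw [show (a : ℂ) ^ 2 * w ^ 2 = ((rPlus M a + rMinus M a) * rPlus M a - rPlus M a ^ 2) * w ^ 2 by rw [ha2], hM2] at hode
  field_simp
  field_simp at hode
  linear_combination hode

end Rho

/-! ### The horizon phase `P = e^{−i(ω t̄ − m φ̄)}` and the local solution `R = P ρ` -/

section Phase

variable {M a : ℝ} {m : ℤ} {w Λ : ℂ} {μ : ℝ}

/-- **The horizon phase** `P(r) = e^{−i(ω t̄(r) − m φ̄(r))}` (`t̄ = Kerr.starTime`, `φ̄ = Kerr.starAngle`).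
[cite: ShlapentokhRothman2014KleinGordon, §2 (2.3)] -/
def hzPhase (M a : ℝ) (m : ℤ) (w : ℂ) (r : ℝ) : ℂ :=
  Complex.exp (-(I * (w * ((starTime M a r : ℝ) : ℂ) - (m : ℂ) * ((starAngle M a r : ℝ) : ℂ))))

/-- `K(r) = ω(r² + a²) − am`. [cite: ShlapentokhRothman2014KleinGordon, §2 (2.3)] -/
def hzK (a : ℝ) (m : ℤ) (w : ℂ) (r : ℝ) : ℂ := w * ((r : ℂ) ^ 2 + a ^ 2) - a * m

/-- The phase never vanishes. [folklore] -/
theorem hzPhase_ne_zero (r : ℝ) : hzPhase M a m w r ≠ 0 := Complex.exp_ne_zero _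

/-- **`P' = −i (K/Δ) P`** on `(r₊, ∞)`. [cite: ShlapentokhRothman2014KleinGordon, §1.2.1] -/
theorem hasDerivAt_hzPhase (h : IsSubextremal M a) {r : ℝ} (hr : rPlus M a < r) :
    HasDerivAt (hzPhase M a m w) (-(I * (hzK a m w r / (delta M a r : ℂ))) * hzPhase M a m w r) r := by
  have hT := (hasDerivAt_starTime h hr).ofReal_comp
  have hA := (hasDerivAt_starAngle h hr).ofReal_comp
  have hlin : HasDerivAt (fun s : ℝ ↦ -(I * (w * ((starTime M a s : ℝ) : ℂ) - (m : ℂ) * ((starAngle M a s : ℝ) : ℂ))))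
      (-(I * (w * (((r ^ 2 + a ^ 2) / delta M a r : ℝ) : ℂ) - (m : ℂ) * (((a / delta M a r : ℝ)) : ℂ)))) r :=
    ((hT.const_mul w).sub (hA.const_mul (m : ℂ))).const_mul I |>.neg
  have hexp := hlin.cexp
  unfold hzPhase
  refine hexp.congr_deriv ?_
  rw [hzK]
  push_cast
  ring

variable (h : IsSubextremal M a) (hK : ‖hzKplus M a m w‖ < hzC M a / 8)
include h hK

/-- The real trace `ρ(r)` and its derivative on `|r − r₊| < 2c/5`. [folklore] -/
theorem hasDerivAt_hzRho_real {r : ℝ} (hr : |r - rPlus M a| < 2 * hzC M a / 5) :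
    HasDerivAt (fun s : ℝ ↦ hzRhoC M a m w Λ μ (s : ℂ)) (hzRhoC' M a m w Λ μ (r : ℂ)) r := by
  have hζ : ‖((r : ℂ)) - rPlus M a‖ < 2 * hzC M a / 5 := by
    rw [show ((r : ℂ)) - rPlus M a = ((r - rPlus M a : ℝ) : ℂ) by push_cast; ring, Complex.norm_real, Real.norm_eq_abs]
    exact hr
  exact (hasDerivAt_hzRhoC (Λ := Λ) (μ := μ) h hK hζ).comp_ofReal

/-- The real trace `ρ'(r)` and its derivative. [folklore] -/
theorem hasDerivAt_hzRho'_real {r : ℝ} (hr : |r - rPlus M a| < 2 * hzC M a / 5) :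
    HasDerivAt (fun s : ℝ ↦ hzRhoC' M a m w Λ μ (s : ℂ)) (hzRhoC'' M a m w Λ μ (r : ℂ)) r := by
  have hζ : ‖((r : ℂ)) - rPlus M a‖ < 2 * hzC M a / 5 := by
    rw [show ((r : ℂ)) - rPlus M a = ((r - rPlus M a : ℝ) : ℂ) by push_cast; ring, Complex.norm_real, Real.norm_eq_abs]
    exact hr
  exact (hasDerivAt_hzRhoC' (Λ := Λ) (μ := μ) h hK hζ).comp_ofReal

/-- **The local radial function** `R_loc = P ρ`. [cite: ShlapentokhRothman2014KleinGordon, §2 (2.3)] -/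
def hzRloc (M a : ℝ) (m : ℤ) (w Λ : ℂ) (μ : ℝ) (r : ℝ) : ℂ := hzPhase M a m w r * hzRhoC M a m w Λ μ (r : ℂ)

/-- Its derivative `R_loc' = P (ρ' − iKρ/Δ)`. [folklore] -/
def hzRloc' (M a : ℝ) (m : ℤ) (w Λ : ℂ) (μ : ℝ) (r : ℝ) : ℂ :=
  hzPhase M a m w r * (hzRhoC' M a m w Λ μ (r : ℂ) - I * (hzK a m w r / (delta M a r : ℂ)) * hzRhoC M a m w Λ μ (r : ℂ))

omit h hK in
/-- `Δ > 0` on `(r₊, ∞)`. [folklore] -/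
theorem delta_pos_of_gt (h : IsSubextremal M a) {r : ℝ} (hr : rPlus M a < r) : 0 < delta M a r := by
  rw [delta_eq_mul h.le]
  exact mul_pos (sub_pos.2 hr) (sub_pos.2 (h.rMinus_lt_rPlus.trans hr))

/-- **`R_loc` is differentiable with derivative `R_loc'`** on `(r₊, r₊ + 2c/5)`. [folklore] -/
theorem hasDerivAt_hzRloc {r : ℝ} (hr : rPlus M a < r) (hr' : r < rPlus M a + 2 * hzC M a / 5) :
    HasDerivAt (hzRloc M a m w Λ μ) (hzRloc' M a m w Λ μ r) r := by
  have habs : |r - rPlus M a| < 2 * hzC M a / 5 := by rw [abs_lt]; constructor <;> linarith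
  have h1 := (hasDerivAt_hzPhase (m := m) (w := w) h hr).mul (hasDerivAt_hzRho_real (Λ := Λ) (μ := μ) h hK habs)
  unfold hzRloc
  refine h1.congr_deriv ?_
  rw [hzRloc']
  ring

/-- **The second-order equation for `R_loc`** in solved form: `R_loc'' = −(Δ'/Δ) R_loc' + (V/Δ²) R_loc`
on `(r₊, r₊ + 2c/5)` — i.e. `Δ(ΔR')' = VR`, SR (2.2). [cite: ShlapentokhRothman2014KleinGordon, §2 (2.2)] -/
theorem hasDerivAt_hzRloc' {r : ℝ} (hr : rPlus M a < r) (hr' : r < rPlus M a + 2 * hzC M a / 5) :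
    HasDerivAt (hzRloc' M a m w Λ μ)
      (-((((2 * r - 2 * M : ℝ)) : ℂ) / (delta M a r : ℂ)) * hzRloc' M a m w Λ μ r +
        kgRadialPotential M a w m Λ μ r / (delta M a r : ℂ) ^ 2 * hzRloc M a m w Λ μ r) r := by
  have habs : |r - rPlus M a| < 2 * hzC M a / 5 := by rw [abs_lt]; constructor <;> linarith
  have hΔ : 0 < delta M a r := delta_pos_of_gt h hr
  have hΔC : (delta M a r : ℂ) ≠ 0 := by exact_mod_cast hΔ.ne'
  -- derivatives of the ingredients
  have hP := hasDerivAt_hzPhase (m := m) (w := w) h hr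
  have hρ := hasDerivAt_hzRho_real (Λ := Λ) (μ := μ) h hK habs
  have hρ' := hasDerivAt_hzRho'_real (Λ := Λ) (μ := μ) h hK habs
  have hKd : HasDerivAt (hzK a m w) (w * (2 * (r : ℂ))) r := by
    unfold hzK
    have hc : HasDerivAt (fun y : ℝ ↦ (y : ℂ)) 1 r := (hasDerivAt_id' r).ofReal_comp
    have h1 : HasDerivAt (fun s : ℝ ↦ (s : ℂ) ^ 2) (2 * (r : ℂ)) r := by
      have hf : (fun s : ℝ ↦ (s : ℂ) ^ 2) = fun s : ℝ ↦ (s : ℂ) * (s : ℂ) := by funext s; ring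
      rw [hf]
      refine (hc.mul hc).congr_deriv ?_
      ring
    have h2 := ((h1.add_const ((a : ℂ) ^ 2)).const_mul w).sub_const ((a : ℂ) * m)
    exact h2
  have hΔd : HasDerivAt (fun s : ℝ ↦ (delta M a s : ℂ)) (((2 * r - 2 * M : ℝ)) : ℂ) r := by
    have h1 : HasDerivAt (delta M a) (2 * r - 2 * M) r := by
      have hid := hasDerivAt_id' r
      have h2 := ((hid.mul hid).sub (hid.const_mul (2 * M))).add_const (a ^ 2)
      have hf : delta M a = fun x ↦ x * x - 2 * M * x + a ^ 2 := by funext x; unfold delta; ring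
      rw [hf]
      refine h2.congr_deriv ?_
      ring
    exact h1.ofReal_comp
  have hKΔ : HasDerivAt (fun s : ℝ ↦ hzK a m w s / (delta M a s : ℂ))
      ((w * (2 * (r : ℂ)) * (delta M a r : ℂ) - hzK a m w r * (((2 * r - 2 * M : ℝ)) : ℂ)) / (delta M a r : ℂ) ^ 2) r :=
    hKd.div hΔd hΔC
  have hinner := (hρ'.sub ((hKΔ.const_mul I).mul hρ))
  have htot := hP.mul hinner
  unfold hzRloc'
  refine htot.congr_deriv ?_
  simp only [Pi.sub_apply, Pi.mul_apply]
  rw [hzRloc, kgRadialPotential, hzK]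
  rw [hzK] at hKΔ
  -- the normal form at `ζ = r`, with leading coefficient `Δ`
  have hζ : ‖((r : ℂ)) - rPlus M a‖ < 2 * hzC M a / 5 := by
    rw [show ((r : ℂ)) - rPlus M a = ((r - rPlus M a : ℝ) : ℂ) by push_cast; ring, Complex.norm_real, Real.norm_eq_abs]
    exact habs
  have hode := hzRhoC_ode (Λ := Λ) (μ := μ) h hK hζ
  have hΔ' : (delta M a r : ℂ) = ((r : ℂ) - rPlus M a) * ((r : ℂ) - rMinus M a) := by
    have := delta_eq_mul h.le r
    exact_mod_cast this
  rw [← hΔ'] at hode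
  have hΔdef : (delta M a r : ℂ) = (r : ℂ) ^ 2 - 2 * M * r + a ^ 2 := by unfold delta; push_cast; ring
  -- abbreviations
  set P := hzPhase M a m w r
  set ρ0 := hzRhoC M a m w Λ μ (r : ℂ)
  set ρ1 := hzRhoC' M a m w Λ μ (r : ℂ)
  set ρ2 := hzRhoC'' M a m w Λ μ (r : ℂ)
  set D : ℂ := (delta M a r : ℂ) with hD
  push_cast
  field_simp
  have hI : I ^ 2 = -1 := Complex.I_sq
  linear_combination (P * D) * hode - (2 * a * m * w * P * ρ0) * hΔdef +
    (P * ρ0 * (w * ((r : ℂ) ^ 2 + a ^ 2) - a * m) ^ 2) * hI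

end Phase

/-! ### Global extension to `(r₊, ∞)` and the horizon form -/

section Global

variable {M a : ℝ} {m : ℤ} {w Λ : ℂ} {μ : ℝ}

/-- `t ↦ (Δ(t) : ℂ)` is smooth. [folklore] -/
theorem contDiff_delta_ofReal {n : WithTop ℕ∞} : ContDiff ℝ n (fun t : ℝ ↦ (delta M a t : ℂ)) := by
  have h : ContDiff ℝ n (delta M a) := by
    have : delta M a = fun t ↦ t ^ 2 - 2 * M * t + a ^ 2 := funext fun t ↦ rfl
    rw [this]
    exact ((contDiff_id.pow 2).sub (contDiff_const.mul contDiff_id)).add contDiff_const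
  exact Complex.ofRealCLM.contDiff.comp h

/-- The coefficient `p = −Δ'/Δ` of the solved form is smooth on `(r₊, ∞)`. [folklore] -/
theorem contDiffOn_hzRadialP (h : IsSubextremal M a) {n : WithTop ℕ∞} :
    ContDiffOn ℝ n (fun t : ℝ ↦ -((((2 * t - 2 * M : ℝ)) : ℂ) / (delta M a t : ℂ))) (Ioi (rPlus M a)) := by
  have hΔ : ∀ t ∈ Ioi (rPlus M a), (delta M a t : ℂ) ≠ 0 := fun t ht ↦ by
    exact_mod_cast (delta_pos_of_gt h ht).ne'
  have h1 : ContDiff ℝ n (fun t : ℝ ↦ (((2 * t - 2 * M : ℝ)) : ℂ)) :=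
    Complex.ofRealCLM.contDiff.comp ((contDiff_const.mul contDiff_id).sub contDiff_const)
  have h2 : ContDiff ℝ n (fun t : ℝ ↦ (delta M a t : ℂ)) := contDiff_delta_ofReal
  have h3 : ContDiffOn ℝ n (fun t : ℝ ↦ -((((2 * t - 2 * M : ℝ)) : ℂ) * (delta M a t : ℂ)⁻¹)) (Ioi (rPlus M a)) :=
    (h1.contDiffOn.mul (h2.contDiffOn.inv hΔ)).neg
  exact h3.congr fun t _ ↦ by rw [div_eq_mul_inv]

/-- The radial potential `V_μ` is smooth in `r`. [folklore] -/
theorem contDiff_kgRadialPotential {n : WithTop ℕ∞} : ContDiff ℝ n (fun t : ℝ ↦ kgRadialPotential M a w m Λ μ t) := by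
  unfold kgRadialPotential
  have c1 : ContDiff ℝ n (fun t : ℝ ↦ (((t ^ 2 + a ^ 2) ^ 2 : ℝ) : ℂ)) :=
    Complex.ofRealCLM.contDiff.comp (((contDiff_id.pow 2).add contDiff_const).pow 2)
  have c2 : ContDiff ℝ n (fun t : ℝ ↦ (((4 * M * a * m * t : ℝ)) : ℂ)) :=
    Complex.ofRealCLM.contDiff.comp (contDiff_const.mul contDiff_id)
  have c3 : ContDiff ℝ n (fun t : ℝ ↦ (delta M a t : ℂ)) := contDiff_delta_ofReal
  have c4 : ContDiff ℝ n (fun t : ℝ ↦ (((μ ^ 2 * t ^ 2 : ℝ)) : ℂ)) :=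
    Complex.ofRealCLM.contDiff.comp (contDiff_const.mul (contDiff_id.pow 2))
  exact (((c1.neg.mul contDiff_const).add (c2.mul contDiff_const)).sub contDiff_const).add
    (c3.mul ((contDiff_const.add contDiff_const).add c4))

/-- The coefficient `q = V/Δ²` of the solved form is smooth on `(r₊, ∞)`. [folklore] -/
theorem contDiffOn_hzRadialQ (h : IsSubextremal M a) {n : WithTop ℕ∞} :
    ContDiffOn ℝ n (fun t : ℝ ↦ kgRadialPotential M a w m Λ μ t / (delta M a t : ℂ) ^ 2) (Ioi (rPlus M a)) := by
  have hΔ : ∀ t ∈ Ioi (rPlus M a), (delta M a t : ℂ) ^ 2 ≠ 0 := fun t ht ↦ by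
    refine pow_ne_zero 2 ?_
    exact_mod_cast (delta_pos_of_gt h ht).ne'
  have h2 : ContDiff ℝ n (fun t : ℝ ↦ (delta M a t : ℂ) ^ 2) := contDiff_delta_ofReal.pow 2
  have hV : ContDiff ℝ n (fun t : ℝ ↦ kgRadialPotential M a w m Λ μ t) := contDiff_kgRadialPotential
  have h3 : ContDiffOn ℝ n (fun t : ℝ ↦ kgRadialPotential M a w m Λ μ t * ((delta M a t : ℂ) ^ 2)⁻¹) (Ioi (rPlus M a)) :=
    hV.contDiffOn.mul (h2.contDiffOn.inv hΔ)
  exact h3.congr fun t _ ↦ by rw [div_eq_mul_inv]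

/-- The real trace of `ρ` is smooth on `|r − r₊| < 2c/5`. [folklore] -/
theorem contDiffOn_hzRho_real (h : IsSubextremal M a) (hK : ‖hzKplus M a m w‖ < hzC M a / 8) {n : WithTop ℕ∞} (hn : n ≤ ∞) :
    ContDiffOn ℝ n (fun s : ℝ ↦ hzRhoC M a m w Λ μ (s : ℂ)) (Ioo (rPlus M a - 2 * hzC M a / 5) (rPlus M a + 2 * hzC M a / 5)) := by
  intro r hr
  have hα := norm_hzParam_zero_lt m w Λ μ h hK
  have hζ : ‖((r : ℂ)) - rPlus M a‖ < 2 * hzC M a / 5 := by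
    rw [show ((r : ℂ)) - rPlus M a = ((r - rPlus M a : ℝ) : ℂ) by push_cast; ring, Complex.norm_real, Real.norm_eq_abs, abs_lt]
    constructor <;> linarith [hr.1, hr.2]
  have hξ := norm_hzXi_lt h hζ
  -- `ξ ↦ heunFun p ξ` is `Cⁿ` over `ℂ` at `ξ₀ = hzXi r`, hence over `ℝ`; compose with the affine map
  have hF : ContDiffAt ℂ n (fun ξ : ℂ ↦ heunFun (hzParam M a m w Λ μ) ξ) (hzXi M a r) :=
    (contDiffAt_heunFun hξ hα hn).comp (hzXi M a r) (contDiffAt_id.prodMk contDiffAt_const)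
  have hF' : ContDiffAt ℝ n (fun ξ : ℂ ↦ heunFun (hzParam M a m w Λ μ) ξ) (hzXi M a r) := hF.restrict_scalars ℝ
  have hlin : ContDiff ℝ n (fun s : ℝ ↦ hzXi M a (s : ℂ)) := by
    unfold hzXi
    exact (Complex.ofRealCLM.contDiff.sub contDiff_const).div_const _
  exact (hF'.comp r hlin.contDiffAt).contDiffWithinAt

/-- The horizon phase is smooth on `(r₊, ∞)`. [folklore] -/
theorem contDiffOn_hzPhase (h : IsSubextremal M a) {n : WithTop ℕ∞} :
    ContDiffOn ℝ n (hzPhase M a m w) (Ioi (rPlus M a)) := by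
  unfold hzPhase
  have hT : ContDiffOn ℝ n (fun r : ℝ ↦ ((starTime M a r : ℝ) : ℂ)) (Ioi (rPlus M a)) :=
    Complex.ofRealCLM.contDiff.comp_contDiffOn (contDiffOn_starTime h)
  have hA : ContDiffOn ℝ n (fun r : ℝ ↦ ((starAngle M a r : ℝ) : ℂ)) (Ioi (rPlus M a)) :=
    Complex.ofRealCLM.contDiff.comp_contDiffOn (contDiffOn_starAngle h)
  exact Complex.contDiff_exp.comp_contDiffOn ((contDiffOn_const.mul ((contDiffOn_const.mul hT).sub (contDiffOn_const.mul hA))).neg)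

/-- **Horizon-regular radial solutions** (SR Lemma 4.5, horizon end, constructive). For
sub-extremal `(M, a)`, `m ∈ ℤ`, complex `ω, Λ`, real `μ`, with `‖2Mr₊ω − am‖ < (r₊ − r₋)/8`, there
are `R f : ℝ → ℂ` with: `R` solves the radial ODE (2.2) on `(r₊, ∞)` (`IsRadialSolution`);
`f` is `C^∞` on `(r₊ − 2(r₊−r₋)/5, ∞)` and `R = e^{−i(ωt̄ − mφ̄)} f` on `(r₊, ∞)` (the horizon
form (2.3): smooth up to `𝓗⁺` in Kerr-star coordinates); `R ≢ 0`; and `R = P ρ` agrees with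
the explicit series solution `hzRloc` on `(r₊, r₊ + 2(r₊−r₋)/5)`.
[cite: ShlapentokhRothman2014KleinGordon, §2 (2.2)–(2.3) and Lemma 4.5] -/
theorem exists_horizonRadial (h : IsSubextremal M a) (hK : ‖hzKplus M a m w‖ < hzC M a / 8) :
    ∃ R f : ℝ → ℂ, IsRadialSolution M a w m Λ μ R ∧
      ContDiffOn ℝ ∞ f (Ioi (rPlus M a - 2 * hzC M a / 5)) ∧
      (∀ r ∈ Ioi (rPlus M a), R r =
        Complex.exp (-(Complex.I * (w * ((starTime M a r : ℝ) : ℂ) - (m : ℂ) * ((starAngle M a r : ℝ) : ℂ)))) * f r) ∧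
      (∃ r ∈ Ioi (rPlus M a), R r ≠ 0) ∧
      EqOn R (hzRloc M a m w Λ μ) (Ioo (rPlus M a) (rPlus M a + 2 * hzC M a / 5)) := by
  have hc := hzC_pos h
  set rp := rPlus M a with hrp_def
  set c := hzC M a with hcdef
  -- coefficients of the solved form
  set pc : ℝ → ℂ := fun t ↦ -((((2 * t - 2 * M : ℝ)) : ℂ) / (delta M a t : ℂ)) with hpc
  set qc : ℝ → ℂ := fun t ↦ kgRadialPotential M a w m Λ μ t / (delta M a t : ℂ) ^ 2 with hqc
  have hp : ContDiffOn ℝ ∞ pc (Ioi rp) := contDiffOn_hzRadialP h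
  have hq : ContDiffOn ℝ ∞ qc (Ioi rp) := contDiffOn_hzRadialQ h
  -- the global solution through the data of `R_loc` at `r₁ = rp + c/5`
  set r₁ := rp + c / 5 with hr₁
  have hr₁I : r₁ ∈ Ioo rp (rp + 2 * c / 5) := by constructor <;> rw [hr₁] <;> linarith
  obtain ⟨u, u', hu0, hu1, hsol⟩ := exists_solution_Ioi hp.continuousOn hq.continuousOn r₁
    (hzRloc M a m w Λ μ r₁) (hzRloc' M a m w Λ μ r₁)
  have husm : ContDiffOn ℝ ∞ u (Ioi rp) := (contDiffOn_of_solution isOpen_Ioi hp hq hsol).1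
  -- the local solution solves the same system on `(rp, rp + 2c/5)`
  have hloc : ∀ t ∈ Ioo rp (rp + 2 * c / 5), HasDerivAt (hzRloc M a m w Λ μ) (hzRloc' M a m w Λ μ t) t ∧
      HasDerivAt (hzRloc' M a m w Λ μ) (pc t * hzRloc' M a m w Λ μ t + qc t * hzRloc M a m w Λ μ t) t := fun t ht ↦
    ⟨hasDerivAt_hzRloc h hK ht.1 ht.2, hasDerivAt_hzRloc' h hK ht.1 ht.2⟩
  have heq : EqOn u (hzRloc M a m w Λ μ) (Ioo rp (rp + 2 * c / 5)) :=
    (eqOn_of_solution_Ioo (hp.continuousOn.mono Ioo_subset_Ioi_self) (hq.continuousOn.mono Ioo_subset_Ioi_self) hr₁I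
      (fun t ht ↦ hsol t ht.1) hloc hu0 hu1).1
  -- the smooth factor `f`
  set ρr : ℝ → ℂ := fun s ↦ hzRhoC M a m w Λ μ (s : ℂ) with hρr
  set f : ℝ → ℂ := fun r ↦ if r < r₁ then ρr r else u r * (hzPhase M a m w r)⁻¹ with hf
  have hf_lo : ∀ r ∈ Ioo (rp - 2 * c / 5) (rp + 2 * c / 5), f r = ρr r := by
    intro r hr
    by_cases hlt : r < r₁
    · simp [hf, hlt]
    · have hr' : r ∈ Ioo rp (rp + 2 * c / 5) := ⟨by rw [hr₁] at hlt; linarith, hr.2⟩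
      simp only [hf, hlt, if_false]
      rw [heq hr', hzRloc, mul_comm, ← mul_assoc, inv_mul_cancel₀ (hzPhase_ne_zero r), one_mul]
  have hf_hi : ∀ r ∈ Ioi r₁, f r = u r * (hzPhase M a m w r)⁻¹ := fun r hr ↦ by
    have : ¬r < r₁ := not_lt.2 (le_of_lt hr)
    simp [hf, this]
  have hfsm : ContDiffOn ℝ ∞ f (Ioi (rp - 2 * c / 5)) := by
    intro r hr
    rcases lt_or_ge r (rp + 2 * c / 5) with hlow | hhigh
    · -- near `r`: `f = ρr`
      have hO : Ioo (rp - 2 * c / 5) (rp + 2 * c / 5) ∈ 𝓝 r := Ioo_mem_nhds hr hlow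
      have h1 : ContDiffAt ℝ ∞ ρr r := (contDiffOn_hzRho_real (Λ := Λ) (μ := μ) h hK le_rfl).contDiffAt hO
      exact (h1.congr_of_eventuallyEq (Filter.eventuallyEq_of_mem hO hf_lo)).contDiffWithinAt
    · -- near `r`: `f = u P⁻¹`
      have hr1 : r₁ < r := by rw [hr₁]; linarith
      have hO : Ioi r₁ ∈ 𝓝 r := Ioi_mem_nhds hr1
      have hrp : rp < r := by linarith
      have hOp : Ioi rp ∈ 𝓝 r := Ioi_mem_nhds hrp
      have h1 : ContDiffAt ℝ ∞ (fun s ↦ u s * (hzPhase M a m w s)⁻¹) r :=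
        (husm.contDiffAt hOp).mul (((contDiffOn_hzPhase (m := m) (w := w) h).contDiffAt hOp).inv (hzPhase_ne_zero r))
      exact (h1.congr_of_eventuallyEq (Filter.eventuallyEq_of_mem hO hf_hi)).contDiffWithinAt
  refine ⟨u, f, ⟨husm, fun r hr ↦ ?_⟩, hfsm, fun r hr ↦ ?_, ?_, heq⟩
  · -- the radial ODE in the `deriv` form
    have hr' : rp < r := hr
    have hΔ : 0 < delta M a r := delta_pos_of_gt h hr'
    have hΔC : (delta M a r : ℂ) ≠ 0 := by exact_mod_cast hΔ.ne'
    have hderiv : ∀ t ∈ Ioi rp, deriv u t = u' t := fun t ht ↦ (hsol t ht).1.deriv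
    have hev : deriv u =ᶠ[𝓝 r] u' := by
      filter_upwards [Ioi_mem_nhds hr'] with t ht using hderiv t ht
    have hΔd : HasDerivAt (fun s : ℝ ↦ (delta M a s : ℂ)) (((2 * r - 2 * M : ℝ)) : ℂ) r := by
      have h1 : HasDerivAt (delta M a) (2 * r - 2 * M) r := by
        have hid := hasDerivAt_id' r
        have h2 := ((hid.mul hid).sub (hid.const_mul (2 * M))).add_const (a ^ 2)
        have hfd : delta M a = fun x ↦ x * x - 2 * M * x + a ^ 2 := by funext x; unfold delta; ring
        rw [hfd]
        refine h2.congr_deriv ?_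
        ring
      exact h1.ofReal_comp
    have hprod : HasDerivAt (fun s : ℝ ↦ (delta M a s : ℂ) * u' s)
        ((((2 * r - 2 * M : ℝ)) : ℂ) * u' r + (delta M a r : ℂ) * (pc r * u' r + qc r * u r)) r := hΔd.mul (hsol r hr).2
    have hfun : (fun s : ℝ ↦ (delta M a s : ℂ) * deriv u s) =ᶠ[𝓝 r] fun s ↦ (delta M a s : ℂ) * u' s := by
      filter_upwards [Ioi_mem_nhds hr'] with t ht
      rw [hderiv t ht]
    rw [hfun.deriv_eq, hprod.deriv, hpc, hqc]
    field_simp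
    ring
  · -- the horizon form
    rcases lt_or_ge r r₁ with hlt | hge
    · have hrI : r ∈ Ioo rp (rp + 2 * c / 5) := ⟨hr, by rw [hr₁] at hlt; linarith⟩
      have hfr : f r = ρr r := hf_lo r ⟨by linarith [hrI.1], hrI.2⟩
      rw [hfr, heq hrI, hzRloc, hzPhase]
    · have hfr : f r = u r * (hzPhase M a m w r)⁻¹ := by
        have : ¬r < r₁ := not_lt.2 hge
        simp [hf, this]
      rw [hfr, ← hzPhase, mul_comm (u r), ← mul_assoc, mul_inv_cancel₀ (hzPhase_ne_zero r), one_mul]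
  · -- non-vanishing near the horizon (`ρ(rp) = 1`)
    have hcont : ContinuousAt ρr rp := by
      have hO : Ioo (rp - 2 * c / 5) (rp + 2 * c / 5) ∈ 𝓝 rp := Ioo_mem_nhds (by linarith) (by linarith)
      exact ((contDiffOn_hzRho_real (Λ := Λ) (μ := μ) h hK le_rfl).contDiffAt hO).continuousAt
    have hval : ρr rp = 1 := by
      simp only [hρr, hzRhoC, hzXi]
      rw [hrp_def, sub_self, zero_div]
      exact heunFun_zero
    have hev : ∀ᶠ s in 𝓝 rp, ρr s ≠ 0 := by
      have := hcont.eventually_ne (by rw [hval]; exact one_ne_zero)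
      exact this
    have hev2 : ∀ᶠ s in 𝓝[>] rp, ρr s ≠ 0 ∧ s ∈ Ioo rp (rp + 2 * c / 5) :=
      (hev.filter_mono nhdsWithin_le_nhds).and (Ioo_mem_nhdsGT (by linarith))
    obtain ⟨s, hs1, hs2⟩ := hev2.exists
    refine ⟨s, hs2.1, ?_⟩
    rw [heq hs2, hzRloc]
    exact mul_ne_zero (hzPhase_ne_zero s) hs1

end Global

end Literature.Barriers.FinalStateConjecture

end
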